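import Summits.BirchSwinnertonDyer.BirchSwinnertonDyer.Theorems.ManinLocalTwoThreeBracketSturmLists
import HarnessLib

/-!
# Bracket–Sturm packaging, file 4/4 (= TURNKEY T-an-g53-EC): `η`-quotient coefficient tables by ONE `decide` — the
# `ha / hb / hc` hypotheses of the Bracket–Sturm headline at ARBITRARY depth

Cell bsd-f2-manin, route `ManinLocalTwoThree` (cruxes C2 `ManinOddAtFour` stmt-22967, C3 `ManinPrimeToThreeAtNine`
stmt-22968).  AUTHOR: planner seat -an gen 53 (TURNKEYS T-an-g53-BS v1.1 `bdf541700739eea7` and T-an-g53-EC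
`195407b5d8884464`, HOME/an/g53/); landed by prover seat p2 gen 29, who only SPLIT the two turnkeys into four tree files
(`…BracketSturmDefs` ⊂ `…BracketSturm` ⊂ `…BracketSturmLists` ⊂ `…EtaCoefficientTables`) for the 400-line lint, all
definitions going to the first; the Lean bodies are byte-identical to the turnkeys section by section.  Fact-free,
standard axioms, `--supports` helper; nothing here proves C2/C3 for all `N`, Manin's conjecture or BSD.

The Bracket–Sturm headline wants INTEGER TABLES `a, b, c : List ℤ` with `∀ n < M, (a.getD n 0 : ℂ) = 𝓠(A)^∧(n)` (idem `B`,
`P.f`) up to `M = ⌊(4k+4)μ₀(N)/12⌋ + 1` (`= μ₀(N) + 1` in weight `2`: `73` at `N = 44, 45`, `97` at `56, 63`, `109` at `54`,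
`289` at `144`).  For (integer combinations of) HOLOMORPHIC `η`-QUOTIENTS this file replaces the `Tendsto` engine by a KERNEL
CHECK of arbitrary depth (the computable tables are in file 1/4, §4):
* §1 `_spec` lemmas of the tables against `𝓠` of the analytic products (`qExpansion_eulerFn`,
  `QExpansionAlgebra.qExpansion_mul/pow_of_nice`, `qExpansion_qParam`);
* §2 the function identity `E·∏_δ φ_δ^{(−r_δ)⁺} = q^a·∏_δ φ_δ^{(r_δ)⁺}` on `ℍ` (p1's `LevelFortyFour.etaQuotient_eq_qParam_pow_mul_prod`)
  and unique division at the level of tables;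
* §3 THE HEADLINE `qExpansion_coeff_eq_of_etaCertificate`: for `E ∈ M_k(Γ₀(N))` with `E = ∏_δ η(δτ)^{r_δ}` pointwise,
  `Σ_δ δ·r_δ = 24a`, and an integer list `e` with `mulList M e (etaDenList M N r) = etaNumList M N r a` — ONE `decide +kernel` —
  the list `e` IS the table of the first `M` `q`-coefficients of `E`; variants for an `η`-pinned cusp form and for any nice function;
* §4 table algebra at the level of forms (`coeff_eq_addList`, `coeff_eq_smulList`, `coeff_eq_of_coe_eq`);  §5 kernel sanity checks.
[cite: Koehler2011, §1.1, §2.1] [cite: Ligozat1975, Prop. 3.2.1] [cite: Apostol1990, Thm. 14.3] [cite: Sturm1987, Thm. 1]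
-/

set_option autoImplicit false
-- lint-debt: the directory name repeats the summit name (sibling precedent `ManinLocalTwoThreeRatioBridge.lean`)
set_option linter.dupNamespace false

noncomputable section

open Complex Filter Topology Set Function Asymptotics
open UpperHalfPlane hiding I
open scoped Real Topology Manifold MatrixGroups ModularForm
open CongruenceSubgroup PowerSeries
open Literature.NumberTheory.ModularForms
open Literature.NumberTheory.EllipticCurves Literature.NumberTheory.EllipticCurves.ModularForms

namespace Summit.BirchSwinnertonDyer.BirchSwinnertonDyer.Theorems.ManinLocalTwoThree.BracketSturm

variable {N : ℕ} [NeZero N] {k : ℤ}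

/-! ## §1 The tables model the `q`-expansions below `M` -/

section Specs

/-- `oneList` models `1`. [folklore] -/
theorem oneList_spec (M : ℕ) : ∀ n < M, (((oneList M).getD n 0 : ℤ) : ℂ) = coeff n (1 : ℂ⟦X⟧) := by
  intro n hn
  rw [oneList, getD_map_range _ hn, coeff_one]
  split_ifs <;> simp

/-- `powList` models powers. [folklore] -/
theorem powList_spec {M : ℕ} {l : List ℤ} {ψ : ℂ⟦X⟧} (h : ∀ n < M, ((l.getD n 0 : ℤ) : ℂ) = coeff n ψ) :
    ∀ (s n : ℕ), n < M → (((powList M l s).getD n 0 : ℤ) : ℂ) = coeff n (ψ ^ s)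
  | 0, n, hn => by rw [pow_zero]; exact oneList_spec M n hn
  | s + 1, n, hn => by
    rw [powList, pow_succ]
    have h1 := mulList_spec (Int.castRingHom ℂ) (ψ₁ := ψ ^ s) (ψ₂ := ψ)
      (fun m hm ↦ by rw [eq_intCast]; exact powList_spec h s m hm)
      (fun m hm ↦ by rw [eq_intCast]; exact h m hm) n hn
    rwa [eq_intCast] at h1

/-- `shiftList a` models multiplication by `X^a`. [folklore] -/
theorem shiftList_spec {M : ℕ} (a : ℕ) {l : List ℤ} {ψ : ℂ⟦X⟧} (h : ∀ n < M, ((l.getD n 0 : ℤ) : ℂ) = coeff n ψ) :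
    ∀ n < M, (((shiftList M a l).getD n 0 : ℤ) : ℂ) = coeff n (X ^ a * ψ) := by
  intro n hn
  rw [shiftList, getD_map_range _ hn, coeff_X_pow_mul']
  split_ifs with ha
  · exact h (n - a) (by omega)
  · simp

/-- `addList` models sums. [folklore] -/
theorem addList_spec {M : ℕ} {l₁ l₂ : List ℤ} {ψ₁ ψ₂ : ℂ⟦X⟧} (h₁ : ∀ n < M, ((l₁.getD n 0 : ℤ) : ℂ) = coeff n ψ₁)
    (h₂ : ∀ n < M, ((l₂.getD n 0 : ℤ) : ℂ) = coeff n ψ₂) :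
    ∀ n < M, (((addList M l₁ l₂).getD n 0 : ℤ) : ℂ) = coeff n (ψ₁ + ψ₂) := by
  intro n hn
  rw [addList, getD_map_range _ hn, Int.cast_add, h₁ n hn, h₂ n hn, map_add]

/-- The table `eulerScaledList M δ` IS `formalEulerScaled δ` below `M`. [cite: Apostol1990, Thm. 14.3] -/
theorem getD_eulerScaledList {M δ n : ℕ} (hn : n < M) :
    (eulerScaledList M δ).getD n 0 = coeff n (formalEulerScaled δ) := by
  rw [eulerScaledList, getD_map_range _ hn, coeff_formalEulerScaled]
  split_ifs with hδ
  · exact (EulerTables.coeff_formalEulerPow_eq_getD ((Nat.div_le_self n δ).trans hn.le)).symm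
  · rfl

/-- … hence agrees with `𝓠(φ_δ)` below `M` (`δ > 0`). [cite: Apostol1990, Thm. 14.3] -/
theorem eulerScaledList_spec {M δ : ℕ} (hδ : 0 < δ) :
    ∀ n < M, (((eulerScaledList M δ).getD n 0 : ℤ) : ℂ) = coeff n (qExpansion 1 (eulerFn δ)) := by
  intro n hn
  rw [getD_eulerScaledList hn, qExpansion_eulerFn hδ, coeff_map, eq_intCast]

/-- `φ_δ` is nice (`δ > 0`). [folklore] -/
theorem nice_eulerFn {δ : ℕ} (hδ : 0 < δ) :
    Periodic (eulerFn δ ∘ ofComplex) 1 ∧ MDifferentiable 𝓘(ℂ) 𝓘(ℂ) (eulerFn δ) ∧ IsBoundedAtImInfty (eulerFn δ) :=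
  ⟨periodic_eulerFn δ, mdifferentiable_eulerFn δ, isBoundedAtImInfty_eulerFn hδ⟩

/-- `q` is nice. [folklore] -/
theorem nice_qParam :
    Periodic ((fun τ : ℍ ↦ Periodic.qParam 1 (τ : ℂ)) ∘ ofComplex) 1 ∧
      MDifferentiable 𝓘(ℂ) 𝓘(ℂ) (fun τ : ℍ ↦ Periodic.qParam 1 (τ : ℂ)) ∧
      IsBoundedAtImInfty (fun τ : ℍ ↦ Periodic.qParam 1 (τ : ℂ)) :=
  ⟨periodic_qParam_one, mdifferentiable_qParam_one, isBoundedAtImInfty_qParam_one⟩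

/-- `eulerProdFn s L` is nice when all `δ ∈ L` are positive. [folklore] -/
theorem nice_eulerProdFn (s : ℕ → ℕ) : ∀ L : List ℕ, (∀ δ ∈ L, 0 < δ) →
    Periodic (eulerProdFn s L ∘ ofComplex) 1 ∧ MDifferentiable 𝓘(ℂ) 𝓘(ℂ) (eulerProdFn s L) ∧
      IsBoundedAtImInfty (eulerProdFn s L)
  | [], _ => by
    rw [eulerProdFn, show (1 : ℍ → ℂ) = fun _ ↦ 1 from rfl]
    exact QExpansionAlgebra.nice_const 1 1
  | δ :: L, hL =>
    QExpansionAlgebra.nice_mul (QExpansionAlgebra.nice_pow (nice_eulerFn (hL δ (by simp))) _)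
      (nice_eulerProdFn s L fun δ' hδ' ↦ hL δ' (by simp [hδ']))

/-- **`eulerProdList` is the table of `eulerProdFn` below `M`.** [folklore] -/
theorem eulerProdList_spec (M : ℕ) (s : ℕ → ℕ) : ∀ L : List ℕ, (∀ δ ∈ L, 0 < δ) →
    ∀ n < M, (((eulerProdList M s L).getD n 0 : ℤ) : ℂ) = coeff n (qExpansion 1 (eulerProdFn s L))
  | [], _ => by
    intro n hn
    rw [eulerProdList, eulerProdFn, show (1 : ℍ → ℂ) = fun _ ↦ 1 from rfl,
      QExpansionAlgebra.qExpansion_const 1 one_pos, coeff_C, oneList, getD_map_range _ hn]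
    split_ifs <;> simp
  | δ :: L, hL => by
    intro n hn
    have hδ : 0 < δ := hL δ (by simp)
    have hL' : ∀ δ' ∈ L, 0 < δ' := fun δ' hδ' ↦ hL δ' (by simp [hδ'])
    rw [eulerProdList, eulerProdFn, QExpansionAlgebra.qExpansion_mul_of_nice one_pos
      (QExpansionAlgebra.nice_pow (nice_eulerFn hδ) _) (nice_eulerProdFn s L hL'),
      QExpansionAlgebra.qExpansion_pow_of_nice one_pos (nice_eulerFn hδ)]
    have h1 := mulList_spec (Int.castRingHom ℂ) (ψ₁ := qExpansion 1 (eulerFn δ) ^ s δ)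
      (ψ₂ := qExpansion 1 (eulerProdFn s L))
      (fun m hm ↦ by rw [eq_intCast]; exact powList_spec (eulerScaledList_spec hδ) (s δ) m hm)
      (fun m hm ↦ by rw [eq_intCast]; exact eulerProdList_spec M s L hL' m hm) n hn
    rwa [eq_intCast] at h1

/-- `𝓠(φ_δ)` has constant term `1`. [folklore] -/
theorem coeff_zero_qExpansion_eulerFn {δ : ℕ} (hδ : 0 < δ) : coeff 0 (qExpansion 1 (eulerFn δ)) = 1 := by
  have h1 : (EulerTables.eulerTruncList 1 0 0).getD 0 0 = 1 := by decide
  rw [qExpansion_eulerFn hδ, coeff_map, coeff_formalEulerScaled, if_pos (dvd_zero δ), Nat.zero_div,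
    EulerTables.coeff_formalEulerPow_eq_getD (M := 0) le_rfl, h1, map_one]

/-- `𝓠(eulerProdFn s L)` has constant term `1`. [folklore] -/
theorem coeff_zero_qExpansion_eulerProdFn (s : ℕ → ℕ) : ∀ L : List ℕ, (∀ δ ∈ L, 0 < δ) →
    coeff 0 (qExpansion 1 (eulerProdFn s L)) = 1
  | [], _ => by
    rw [eulerProdFn, show (1 : ℍ → ℂ) = fun _ ↦ 1 from rfl, QExpansionAlgebra.qExpansion_const 1 one_pos, coeff_C,
      if_pos rfl]
  | δ :: L, hL => by
    have hδ : 0 < δ := hL δ (by simp)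
    have hL' : ∀ δ' ∈ L, 0 < δ' := fun δ' hδ' ↦ hL δ' (by simp [hδ'])
    rw [eulerProdFn, QExpansionAlgebra.qExpansion_mul_of_nice one_pos
      (QExpansionAlgebra.nice_pow (nice_eulerFn hδ) _) (nice_eulerProdFn s L hL'),
      QExpansionAlgebra.qExpansion_pow_of_nice one_pos (nice_eulerFn hδ), coeff_zero_eq_constantCoeff_apply,
      map_mul, map_pow, ← coeff_zero_eq_constantCoeff_apply, ← coeff_zero_eq_constantCoeff_apply,
      coeff_zero_qExpansion_eulerFn hδ, coeff_zero_qExpansion_eulerProdFn s L hL', one_pow, one_mul]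

/-- `eulerProdFn` evaluates to the list product. [folklore] -/
theorem eulerProdFn_apply (s : ℕ → ℕ) (τ : ℍ) :
    ∀ L : List ℕ, eulerProdFn s L τ = (L.map fun δ ↦ eulerFn δ τ ^ s δ).prod
  | [] => rfl
  | δ :: L => by
    rw [eulerProdFn, Pi.mul_apply, Pi.pow_apply, eulerProdFn_apply s τ L, List.map_cons, List.prod_cons]

/-- Members of `divisorsList N` are positive. [folklore] -/
theorem pos_of_mem_divisorsList {N δ : ℕ} (h : δ ∈ divisorsList N) : 0 < δ := by
  simp only [divisorsList, List.mem_filter, List.mem_range, decide_eq_true_eq] at h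
  exact h.2.1

omit [NeZero N] in
/-- `divisorsList N` has no duplicates. [folklore] -/
theorem divisorsList_nodup (N : ℕ) : (divisorsList N).Nodup := List.nodup_range.filter _

omit [NeZero N] in
/-- `divisorsList N` enumerates `N.divisors` (`N ≠ 0`). [folklore] -/
theorem divisorsList_toFinset (hN : N ≠ 0) : (divisorsList N).toFinset = N.divisors := by
  ext δ
  simp only [divisorsList, List.mem_toFinset, List.mem_filter, List.mem_range, decide_eq_true_eq,
    Nat.mem_divisors]
  constructor
  · rintro ⟨-, -, h⟩
    exact ⟨h, hN⟩
  · rintro ⟨h, -⟩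
    have hδ : δ ≠ 0 := by
      rintro rfl
      exact hN (Nat.eq_zero_of_zero_dvd h)
    exact ⟨Nat.lt_succ_of_le (Nat.le_of_dvd (Nat.pos_of_ne_zero hN) h), Nat.pos_of_ne_zero hδ, h⟩

omit [NeZero N] in
/-- **`eulerProdFn` over `divisorsList N` is the divisor product.** [folklore] -/
theorem eulerProdFn_divisorsList (hN : N ≠ 0) (s : ℕ → ℕ) (τ : ℍ) :
    eulerProdFn s (divisorsList N) τ = ∏ δ ∈ N.divisors, eulerFn δ τ ^ s δ := by
  rw [eulerProdFn_apply, ← divisorsList_toFinset hN, List.prod_toFinset _ (divisorsList_nodup N)]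

end Specs

/-! ## §2 `E · den = q^a · num` on `ℍ` and unique division at the level of tables -/

section Identity

omit [NeZero N] in
/-- **`E·den = num` on `ℍ`:** for `Σ_δ δ r_δ = 24a`,
`(∏_δ η(δτ)^{r_δ}) · ∏_δ φ_δ^{(−r_δ)⁺} = q^a · ∏_δ φ_δ^{(r_δ)⁺}`. [cite: Koehler2011, §2.1] -/
theorem etaQuotient_mul_prod_eq (r : ℕ → ℤ) (a : ℕ) (hS : ∑ δ ∈ N.divisors, (δ : ℤ) * r δ = 24 * a) (τ : ℍ) :
    etaQuotient N r τ * ∏ δ ∈ N.divisors, eulerFn δ τ ^ (-r δ).toNat =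
      Periodic.qParam 1 (τ : ℂ) ^ a * ∏ δ ∈ N.divisors, eulerFn δ τ ^ (r δ).toNat := by
  rw [LevelFortyFour.etaQuotient_eq_qParam_pow_mul_prod N r a hS τ, mul_assoc, ← Finset.prod_mul_distrib]
  congr 1
  refine Finset.prod_congr rfl fun δ hδ ↦ ?_
  have hx : eulerFn δ τ ≠ 0 := eulerFn_ne_zero (Nat.pos_of_mem_divisors hδ) τ
  rw [← zpow_natCast, ← zpow_natCast, ← zpow_add₀ hx]
  congr 1
  have := Int.toNat_sub_toNat_neg (r δ)
  omega

/-- **Unique division by a series with constant term `1`, at the level of tables:** if `Ψ·D = Q`, `D^∧(0) = 1`,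
`den` / `num` are the tables of `D` / `Q` below `M` and `e ⋆ den ≡ num (mod X^M)`, then `e` is the table of `Ψ`.
[folklore] -/
theorem getD_eq_coeff_of_mulList_eq {M : ℕ} {e den num : List ℤ} {Ψ D Q : ℂ⟦X⟧} (hmul : Ψ * D = Q)
    (hD₀ : coeff 0 D = 1) (hden : ∀ n < M, ((den.getD n 0 : ℤ) : ℂ) = coeff n D)
    (hnum : ∀ n < M, ((num.getD n 0 : ℤ) : ℂ) = coeff n Q) (hcert : mulList M e den = num) :
    ∀ n < M, ((e.getD n 0 : ℤ) : ℂ) = coeff n Ψ := by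
  intro n
  induction n using Nat.strong_induction_on with
  | _ n ih =>
    intro hn
    have h1 : (((mulList M e den).getD n 0 : ℤ) : ℂ) = coeff n Q := by rw [hcert]; exact hnum n hn
    rw [← hmul, coeff_mul, Finset.Nat.sum_antidiagonal_eq_sum_range_succ_mk, getD_mulList _ _ _ hn, Int.cast_sum,
      Finset.sum_range_succ, Finset.sum_range_succ] at h1
    have hS : ∑ i ∈ Finset.range n, (((e.getD i 0 * den.getD (n - i) 0 : ℤ)) : ℂ) =
        ∑ i ∈ Finset.range n, coeff i Ψ * coeff (n - i) D := by
      refine Finset.sum_congr rfl fun i hi ↦ ?_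
      have hi' : i < n := Finset.mem_range.mp hi
      rw [Int.cast_mul, ih i hi' (by omega), hden (n - i) (by omega)]
    rw [hS, Int.cast_mul, Nat.sub_self, hden 0 (by omega), hD₀, mul_one, mul_one] at h1
    exact add_left_cancel h1

end Identity

/-! ## §3 The headline: the coefficient table of an `η`-quotient form by ONE `decide` -/

section Headline

/-- **COEFFICIENT TABLE OF AN `η`-QUOTIENT, nice-function form.** `F` nice (1-periodic, holomorphic, bounded at
`i∞`) with `F = ∏_δ η(δτ)^{r_δ}` pointwise, `Σ_δ δ·r_δ = 24a`, and an integer list `e` with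
`mulList M e (etaDenList M N r) = etaNumList M N r a` (decidable): then `e` is the table of the first `M`
`q`-coefficients of `F`. [cite: Koehler2011, §2.1] [cite: Ligozat1975, Prop. 3.2.1] -/
theorem qExpansion_coeff_eq_of_etaCertificate_of_nice {F : ℍ → ℂ}
    (hF : Periodic (F ∘ ofComplex) 1 ∧ MDifferentiable 𝓘(ℂ) 𝓘(ℂ) F ∧ IsBoundedAtImInfty F) (r : ℕ → ℤ)
    (hE : ∀ τ : ℍ, F τ = etaQuotient N r τ) (a : ℕ) (hS : ∑ δ ∈ N.divisors, (δ : ℤ) * r δ = 24 * a) {M : ℕ}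
    (e : List ℤ) (hcert : mulList M e (etaDenList M N r) = etaNumList M N r a) :
    ∀ n < M, ((e.getD n 0 : ℤ) : ℂ) = (qExpansion 1 F).coeff n := by
  have hN : N ≠ 0 := NeZero.ne N
  have hpos : ∀ δ ∈ divisorsList N, 0 < δ := fun δ h ↦ pos_of_mem_divisorsList h
  set Den : ℍ → ℂ := eulerProdFn (fun δ ↦ (-r δ).toNat) (divisorsList N) with hDen
  set Num₀ : ℍ → ℂ := eulerProdFn (fun δ ↦ (r δ).toNat) (divisorsList N) with hNum₀
  have nDen := nice_eulerProdFn (fun δ ↦ (-r δ).toNat) (divisorsList N) hpos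
  have nNum₀ := nice_eulerProdFn (fun δ ↦ (r δ).toNat) (divisorsList N) hpos
  have hfun : F * Den = (fun τ : ℍ ↦ Periodic.qParam 1 (τ : ℂ)) ^ a * Num₀ := by
    funext τ
    rw [Pi.mul_apply, Pi.mul_apply, Pi.pow_apply, hE τ, hDen, hNum₀, eulerProdFn_divisorsList hN,
      eulerProdFn_divisorsList hN, etaQuotient_mul_prod_eq r a hS τ]
  have hq : qExpansion 1 F * qExpansion 1 Den = X ^ a * qExpansion 1 Num₀ := by
    rw [← QExpansionAlgebra.qExpansion_mul_of_nice one_pos hF nDen, hfun,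
      QExpansionAlgebra.qExpansion_mul_of_nice one_pos (QExpansionAlgebra.nice_pow nice_qParam a) nNum₀,
      QExpansionAlgebra.qExpansion_pow_of_nice one_pos nice_qParam, qExpansion_qParam]
  have hD₀ : coeff 0 (qExpansion 1 Den) = 1 := coeff_zero_qExpansion_eulerProdFn _ _ hpos
  intro n hn
  exact getD_eq_coeff_of_mulList_eq hq hD₀ (eulerProdList_spec M _ _ hpos)
    (shiftList_spec a (eulerProdList_spec M _ _ hpos)) hcert n hn

/-- **COEFFICIENT TABLE OF AN `η`-QUOTIENT FORM BY ONE `decide`.**  `E ∈ M_k(Γ₀(N))` with `E = ∏_δ η(δτ)^{r_δ}`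
pointwise (for the tree's `etaQuotientModularForm N r k …` this is `fun _ ↦ rfl`), `Σ_δ δ·r_δ = 24a`, and an
integer list `e` with `mulList M e (etaDenList M N r) = etaNumList M N r a`: then
`∀ n < M, (e.getD n 0 : ℂ) = 𝓠(E)^∧(n)` — the shape of the `ha`/`hb` hypotheses of
`abs_maninConstant_eq_one_of_defectList_eq_zero`. [cite: Koehler2011, §2.1] [cite: Ligozat1975, Prop. 3.2.1] -/
theorem qExpansion_coeff_eq_of_etaCertificate (E : ModularForm (Gamma0 N) k) (r : ℕ → ℤ)
    (hE : ∀ τ : ℍ, E τ = etaQuotient N r τ) (a : ℕ) (hS : ∑ δ ∈ N.divisors, (δ : ℤ) * r δ = 24 * a) {M : ℕ}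
    (e : List ℤ) (hcert : mulList M e (etaDenList M N r) = etaNumList M N r a) :
    ∀ n < M, ((e.getD n 0 : ℤ) : ℂ) = (qExpansion 1 ⇑E).coeff n :=
  qExpansion_coeff_eq_of_etaCertificate_of_nice (nice_coe E) r hE a hS e hcert

/-- **Cusp-form variant** (the `hc` hypothesis when the newform is pinned as an `η`-quotient, `⇑P.f = ∏_δ η(δτ)^{r_δ}`
as in the level-`27/32/36/144` files). [cite: Koehler2011, §2.1] [cite: MartinOno1997, Thm. 2] -/
theorem qExpansion_coeff_eq_of_etaCertificate_cuspForm {k' : ℤ} (f : CuspForm (Gamma0 N) k') (r : ℕ → ℤ)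
    (hf : ∀ τ : ℍ, f τ = etaQuotient N r τ) (a : ℕ) (hS : ∑ δ ∈ N.divisors, (δ : ℤ) * r δ = 24 * a) {M : ℕ}
    (e : List ℤ) (hcert : mulList M e (etaDenList M N r) = etaNumList M N r a) :
    ∀ n < M, ((e.getD n 0 : ℤ) : ℂ) = (qExpansion 1 ⇑f).coeff n :=
  qExpansion_coeff_eq_of_etaCertificate_of_nice (nice_coe_cuspForm f) r hf a hS e hcert

end Headline

/-! ## §4 Table algebra at the level of forms: `A = Σ cᵢ Eᵢ` -/

section TableAlgebra

/-- Tables add along sums of nice functions. [folklore] -/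
theorem coeff_eq_addList_of_nice {F G : ℍ → ℂ}
    (hF : Periodic (F ∘ ofComplex) 1 ∧ MDifferentiable 𝓘(ℂ) 𝓘(ℂ) F ∧ IsBoundedAtImInfty F)
    (hG : Periodic (G ∘ ofComplex) 1 ∧ MDifferentiable 𝓘(ℂ) 𝓘(ℂ) G ∧ IsBoundedAtImInfty G) {M : ℕ}
    {a b : List ℤ} (ha : ∀ n < M, ((a.getD n 0 : ℤ) : ℂ) = (qExpansion 1 F).coeff n)
    (hb : ∀ n < M, ((b.getD n 0 : ℤ) : ℂ) = (qExpansion 1 G).coeff n) :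
    ∀ n < M, (((addList M a b).getD n 0 : ℤ) : ℂ) = (qExpansion 1 (F + G)).coeff n := by
  rw [QExpansionAlgebra.qExpansion_add_of_nice one_pos hF hG]
  exact addList_spec ha hb

/-- Tables scale along `(c : ℂ) • F`, `c ∈ ℤ`. [folklore] -/
theorem coeff_eq_smulList_of_nice {F : ℍ → ℂ}
    (hF : Periodic (F ∘ ofComplex) 1 ∧ MDifferentiable 𝓘(ℂ) 𝓘(ℂ) F ∧ IsBoundedAtImInfty F) {M : ℕ} (c : ℤ)
    {a : List ℤ} (ha : ∀ n < M, ((a.getD n 0 : ℤ) : ℂ) = (qExpansion 1 F).coeff n) :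
    ∀ n < M, (((smulList M c a).getD n 0 : ℤ) : ℂ) = (qExpansion 1 ((c : ℂ) • F)).coeff n := by
  intro n hn
  rw [QExpansionAlgebra.qExpansion_smul_of_nice one_pos _ hF, map_smul, smul_eq_mul, smulList,
    getD_map_range _ hn, Int.cast_mul, ha n hn]

/-- **Table of `E₁ + E₂`.** [folklore] -/
theorem coeff_eq_addList (E₁ E₂ : ModularForm (Gamma0 N) k) {M : ℕ} {a b : List ℤ}
    (ha : ∀ n < M, ((a.getD n 0 : ℤ) : ℂ) = (qExpansion 1 ⇑E₁).coeff n)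
    (hb : ∀ n < M, ((b.getD n 0 : ℤ) : ℂ) = (qExpansion 1 ⇑E₂).coeff n) :
    ∀ n < M, (((addList M a b).getD n 0 : ℤ) : ℂ) = (qExpansion 1 ⇑(E₁ + E₂)).coeff n := by
  rw [ModularForm.coe_add]
  exact coeff_eq_addList_of_nice (nice_coe E₁) (nice_coe E₂) ha hb

/-- **Table of `(c : ℂ) • E`, `c ∈ ℤ`.** [folklore] -/
theorem coeff_eq_smulList (E : ModularForm (Gamma0 N) k) {M : ℕ} (c : ℤ) {a : List ℤ}
    (ha : ∀ n < M, ((a.getD n 0 : ℤ) : ℂ) = (qExpansion 1 ⇑E).coeff n) :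
    ∀ n < M, (((smulList M c a).getD n 0 : ℤ) : ℂ) = (qExpansion 1 ⇑((c : ℂ) • E)).coeff n := by
  rw [ModularForm.IsGLPos.coe_smul]
  exact coeff_eq_smulList_of_nice (nice_coe E) c ha

/-- Tables transport along an equality of functions (the PINNING `⇑P.f = ⇑F` of a level file). [folklore] -/
theorem coeff_eq_of_coe_eq {F G : ℍ → ℂ} (h : F = G) {M : ℕ} {a : List ℤ}
    (ha : ∀ n < M, ((a.getD n 0 : ℤ) : ℂ) = (qExpansion 1 G).coeff n) :
    ∀ n < M, ((a.getD n 0 : ℤ) : ℂ) = (qExpansion 1 F).coeff n := by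
  subst h
  exact ha

end TableAlgebra

/-! ## §5 Kernel sanity checks -/

section Sanity

/-- `φ₂^∧ = 1 − q² − q⁴ + ⋯` (`M = 6`). [folklore] -/
example : eulerScaledList 6 2 = [1, 0, -1, 0, -1, 0] := by decide +kernel

/-- The divisors of `44`. [folklore] -/
example : divisorsList 44 = [1, 2, 4, 11, 22, 44] := by decide +kernel

/-- `η(4τ)⁸/η(τ)⁸` (level `4`, `Σ δ r_δ = 24`): denominator `∏(1−qⁿ)⁸ = 1 − 8q + 20q² − 70q⁴ + 64q⁵ + ⋯`,
numerator `q·∏(1−q^{4n})⁸ = q − 8q⁵ + ⋯`, and the certificate of the table `q + 8q² + 44q³ + 192q⁴ + 718q⁵`.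
[folklore] -/
example : etaDenList 6 4 (fun δ ↦ if δ = 1 then -8 else if δ = 4 then 8 else 0) = [1, -8, 20, 0, -70, 64] := by
  decide +kernel

example : etaNumList 6 4 (fun δ ↦ if δ = 1 then -8 else if δ = 4 then 8 else 0) 1 = [0, 1, 0, 0, 0, -8] := by
  decide +kernel

example : mulList 6 [0, 1, 8, 44, 192, 718] (etaDenList 6 4 (fun δ ↦ if δ = 1 then -8 else if δ = 4 then 8 else 0)) =
    etaNumList 6 4 (fun δ ↦ if δ = 1 then -8 else if δ = 4 then 8 else 0) 1 := by
  decide +kernel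

end Sanity

end Summit.BirchSwinnertonDyer.BirchSwinnertonDyer.Theorems.ManinLocalTwoThree.BracketSturm

end
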